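import Summits.QuantumFields.YangMills.Theorems.BalabanUVNodesN15KingModelComplexLinkSharpWindow
import Summits.QuantumFields.YangMills.Theorems.BalabanUVNodesN15KingModelComplexLinkPerturbation
import Summits.QuantumFields.YangMills.Theorems.BalabanUVNodesN15KingModelComplexLinkSpectrum
import Summits.QuantumFields.YangMills.Theorems.BalabanUVNodesN15KingModelComplexLinkGauge
import Summits.QuantumFields.YangMills.Theorems.BalabanUVNodesN15KingModelComplexLinkCauchy
import Summits.QuantumFields.YangMills.Theorems.BalabanUVNodesN15KingModelComplexLinkExpChart
import HarnessLib
/-!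
# BalabanUVNodes ∕ N15 — THE KING-MODEL RUNG (PART Ϛ-i): PART Ϛ BY NAME — «ANALYTICITY IN THE LINK FIELD» ([Balaban1985BackgroundPropagators] §3.B, Thm 3.4) DECIDED IN KING's `A = 0`
# MODEL ON THE FINE COVARIANCE LAYER, in three package theorems: the complex window (existence, domination at shifted parameters, all the inequalities, holomorphy, exact derivative,
# first-order perturbation, spectrum), its sharpness and gauge structure, and the `ℂ`-side (determinant window, Cauchy estimates, the exponential chart)
# (Track A, DAG node N15 = NE2; FAN-OUT v1.1 §N15 s3 «KING-MODEL RUNG … + what the curved case adds»; count-neutral)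
HONEST FRAMING.  Count-neutral (cell `pub-ymgap`, seat `pub-ymgap-dag-n15-e` g43; `--supports stmt-QuantumFields-27247 --as helper` = K3ᴬ, KEY MAP v3).  One finite torus at fixed
spacing; King's `A = 0` COMPARISON model, FINE covariance layer only (PART Ͱ-j: the full `G_k(U)` with the averaging penalty is not Kato-dominated — nothing here transfers to it);
the complexification is by norm-bounded TWO-SIDED transporters `(U,V)` (print's `U′U`, `U′ = e^{iηA}`, `A ∈ gᶜ` is the slice `V = U⁻¹`, PART Ϛ-j); nothing of Bałaban's (3.42) ∕ Thm 3.4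
for `G(U)` is asserted; nothing continuum ∕ ℝ⁴ ∕ OS ∕ Clay; NOT a node discharge (N15 of record untouched).  This file only CONJOINS parts Ϛ-a … Ϛ-k by name.
* ★★★ `king_complex_window_package` — for `c ≥ 0`, `m² > 0`, `0 ≤ ε`, `2(d+1)cε < m²` and every two-sided field with `‖U(b)‖, ‖V(b)‖ ≤ 1+ε`: (i) `M_{U,V}` invertible (Ϛ-b); (ii) `‖(G_{U,V})_{xy}‖ ≤
  (lapF K ((1+ε)c) (m²−2(d+1)cε))⁻¹(x,y)` (Ϛ-b); (iii) uniform exponential decay with King's shifted constants (Ϛ-c); (iv) mass bound `≤ 1∕m′²` and (v) row sums `≤ 1∕m′²` (Ϛ-c); (vi) `(U,V) ↦ G`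
  analytic at `(U,V)` (Ϛ-e); (vii) the exact derivative `G·T_δ·G` (Ϛ-e); (viii) Lipschitz in the sup distance with constant `2(d+1)c∕m′⁴` (Ϛ-f); (ix) block Gershgorin `‖D₀ − λ‖ ≤ 2(d+1)(1+ε)c` for
  every eigenpair (Ϛ-g).
* ★★★ `king_complex_window_structure` — (`c > 0`, `m² > 0`, `ε ≥ 0`, nonempty fibre): (i) the two-sided window is SHARP and (ii) so is the Hermitian one (Ϛ-d); (iii) at `ε = 0` on unitary
  fields the domination is PART Ͱ-b's verbatim (Ϛ-b); (iv) every pure `GL(n)` gauge is invertible (Ϛ-h); (v) invertibility ∕ (vi) determinant are `GL(n)`-gauge invariant (Ϛ-h).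
* ★★ `king_complex_window_package_complex` (`𝕜 = ℂ`) — (i)∕(ii) the determinant window `(m′²)^N ≤ ‖det M_{U,V}‖ ≤ (m²+2(d+1)c(2+ε))^N` (Ϛ-g); (iii) Cauchy estimates along complex lines, all orders
  (Ϛ-k); (iv) `A ↦ G(e^{A}U₀)` analytic at `A = 0` for every unitary `U₀` (Ϛ-j).
Dedup (rg at filing): basename 0 files; needles `king_complex_window` 0 tree files.  Locators: [Balaban1985BackgroundPropagators] §3.B p.399 l.25–40, Thm 3.4 p.400, p.400 l.1–12, (3.50)–(3.53)
p.400, (3.57) p.401, (3.23) p.394, (3.42) p.397, p.398 l.19 ∕ l.26–27; [King1986] (4.4) p.670, (2.17) p.653, (3.89) p.668, (4.38) p.674.  0 `sorry`, 0 `def`.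
-/

noncomputable section
open scoped BigOperators ComplexConjugate ComplexOrder Topology Matrix.Norms.L2Operator
open Finset Matrix Filter

namespace Summit.QuantumFields.YangMills.BalabanUVNodes.N15KingModelRung.Covariant

open Literature.MathematicalPhysics.QuantumFieldTheory.LatticeDiamagneticInequality (Hopping blk)
open Literature.MathematicalPhysics.QuantumFieldTheory.Balaban1983to89.B5Prop11Plancherel (Tor unitVec)
open Literature.MathematicalPhysics.QuantumFieldTheory.Balaban1983to89.B4TorusKernel (periodConst)
open Literature.MathematicalPhysics.QuantumFieldTheory.King1986.Torus (lapF tdistT)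
open Summit.QuantumFields.YangMills.BalabanUVNodes.N15KingModelRung.TorusSpectral (kappaFree)

variable {d : ℕ} (K : Fin (d + 1) → ℕ) [hK : ∀ μ, NeZero (K μ)]
variable {𝕜 : Type*} [RCLike 𝕜] {n : Type*} [Fintype n] [DecidableEq n] {c m2 ε : ℝ}

/-- ★★★ **PART Ϛ BY NAME, I — THE COMPLEX WINDOW**: for `c ≥ 0`, `m² > 0`, `0 ≤ ε` with `2(d+1)cε < m²`, and every two-sided link field with `‖U(b)‖, ‖V(b)‖ ≤ 1+ε` on all bonds
(`m′² := m² − 2(d+1)cε`, `K′ := (lapF K ((1+ε)c) m′²)⁻¹` King's `A = 0` kernel at the shifted parameters): (i) `M_{U,V}` is invertible; (ii) `‖(G_{U,V})_{xy}‖_{op} ≤ K′(x,y)`; (iii) uniform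
exponential decay with King's constants at the shifted parameters; (iv) `‖(G_{U,V})_{xy}‖_{op} ≤ 1∕m′²`; (v) `Σ_y‖(G_{U,V})_{xy}‖_{op} ≤ 1∕m′²`; (vi) `(U,V) ↦ G` is analytic at `(U,V)`;
(vii) its Fréchet derivative is `δ ↦ G·T_δ·G`; (viii) Lipschitz: a second window pair at sup distance `δ` has `‖(G − G′)_{xy}‖ ≤ 2(d+1)c·δ∕m′⁴`; (ix) every eigenpair `M_{U,V}v = λv`, `v ≠ 0`, has
`‖D₀ − λ‖ ≤ 2(d+1)(1+ε)c`.  [B9] Thm 3.4 («extend … analytic … satisfy all the inequalities … correspondingly») and p.400 l.10–12 («small perturbations») in King's model.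
[cite: Balaban1985BackgroundPropagators, Thm 3.4 p.400, §3.B p.399 l.37–40, p.400 l.10–12, (3.57) p.401, (3.42) p.397; King1986, (4.4) p.670, (4.38) p.674] -/
theorem king_complex_window_package (hc : 0 ≤ c) (hm : 0 < m2) (hε : 0 ≤ ε) (hwin : 2 * ((d : ℝ) + 1) * c * ε < m2)
    {U V : Tor K × Fin (d + 1) → Matrix n n 𝕜} (hU : ∀ b, ‖U b‖ ≤ 1 + ε) (hV : ∀ b, ‖V b‖ ≤ 1 + ε) :
    IsUnit (cxLapF K c m2 U V)
    ∧ (∀ x y, ‖blk (cxLapF K c m2 U V)⁻¹ x y‖ ≤ (lapF K ((1 + ε) * c) (m2 - 2 * ((d : ℝ) + 1) * c * ε))⁻¹ x y)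
    ∧ (∀ x y, ‖blk (cxLapF K c m2 U V)⁻¹ x y‖
        ≤ 2 / (m2 - 2 * ((d : ℝ) + 1) * c * ε) * periodConst (kappaFree ((1 + ε) * c) (m2 - 2 * ((d : ℝ) + 1) * c * ε) d) d
            * Real.exp (-(kappaFree ((1 + ε) * c) (m2 - 2 * ((d : ℝ) + 1) * c * ε) d / (d + 1) * tdistT K x y)))
    ∧ (∀ x y, ‖blk (cxLapF K c m2 U V)⁻¹ x y‖ ≤ (m2 - 2 * ((d : ℝ) + 1) * c * ε)⁻¹)
    ∧ (∀ x, ∑ y, ‖blk (cxLapF K c m2 U V)⁻¹ x y‖ ≤ (m2 - 2 * ((d : ℝ) + 1) * c * ε)⁻¹)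
    ∧ AnalyticAt 𝕜 (fun UV : CxLinks K 𝕜 n => (cxLapF K c m2 UV.1 UV.2)⁻¹) (U, V)
    ∧ HasFDerivAt (fun UV : CxLinks K 𝕜 n => (cxLapF K c m2 UV.1 UV.2)⁻¹)
        ((ContinuousLinearMap.mulLeftRight 𝕜 (Matrix (Tor K × n) (Tor K × n) 𝕜) (cxLapF K c m2 U V)⁻¹ (cxLapF K c m2 U V)⁻¹).comp (cxHopCLM K 𝕜 n c)) (U, V)
    ∧ (∀ {U' V' : Tor K × Fin (d + 1) → Matrix n n 𝕜} {δ : ℝ}, (∀ b, ‖U' b‖ ≤ 1 + ε) → (∀ b, ‖V' b‖ ≤ 1 + ε) →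
        (∀ b, ‖U b - U' b‖ ≤ δ) → (∀ b, ‖V b - V' b‖ ≤ δ) → ∀ x y,
        ‖blk ((cxLapF K c m2 U V)⁻¹ - (cxLapF K c m2 U' V')⁻¹) x y‖
          ≤ 2 * ((d : ℝ) + 1) * c * δ * ((m2 - 2 * ((d : ℝ) + 1) * c * ε)⁻¹ * (m2 - 2 * ((d : ℝ) + 1) * c * ε)⁻¹))
    ∧ (∀ {μ : 𝕜} {v : Tor K × n → 𝕜}, v ≠ 0 → cxLapF K c m2 U V *ᵥ v = μ • v →
        ‖(((m2 + 2 * ((d : ℝ) + 1) * c : ℝ) : 𝕜)) - μ‖ ≤ 2 * ((d : ℝ) + 1) * ((1 + ε) * c)) :=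
  ⟨isUnit_cxLapF K hc hm hε hwin hU hV,
   fun x y => l2_opNorm_blk_cxLapF_inv_le K hc hm hε hwin hU hV x y,
   fun x y => l2_opNorm_blk_cxLapF_inv_le_exp_tdistT K hc hm hε hwin hU hV x y,
   fun x y => l2_opNorm_blk_cxLapF_inv_le_inv_mass K hc hm hε hwin hU hV x y,
   fun x => sum_l2_opNorm_blk_cxLapF_inv_le K hc hm hε hwin hU hV x,
   analyticAt_cxLapF_inv K (UV₀ := ((U, V) : CxLinks K 𝕜 n)) (isUnit_cxLapF K hc hm hε hwin hU hV),
   hasFDerivAt_cxLapF_inv K (UV₀ := ((U, V) : CxLinks K 𝕜 n)) (isUnit_cxLapF K hc hm hε hwin hU hV),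
   fun hU' hV' hdU hdV x y => l2_opNorm_blk_cxLapF_inv_sub_inv_le_of_sup K hc hm hε hwin hU hV hU' hV' hdU hdV x y,
   fun hv h => norm_D0_sub_eigenvalue_le K hc hε hU hV hv h⟩

/-- ★★★ **PART Ϛ BY NAME, II — THE STRUCTURE OF THE WINDOW**: for `c > 0`, `m² > 0`, `ε ≥ 0` and a nonempty fibre: (i) the two-sided window is SHARP — (all fields of norm `≤ 1+ε` are
invertible) ⟺ `2(d+1)cε < m²`; (ii) the same on PART Ͱ's Hermitian slice `−cΔ_U+m²`; (iii) at a unitary `U` the two-sided bound is PART Ͱ-b's `‖(G_U)_{xy}‖ ≤ (lapF K c m²)⁻¹(x,y)` verbatim;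
(iv) every pure complex gauge `(g(x)g(x+e_μ)⁻¹, g(x+e_μ)g(x)⁻¹)`, `g : T → GL(n)`, is invertible WHATEVER its size; (v) invertibility and (vi) the determinant are invariant under the complexified
gauge group. [cite: Balaban1985BackgroundPropagators, Thm 3.4 p.400 (l.4 «α₁ … sufficiently small»), p.398 l.19, §3.B p.399 l.37–40; King1986, (4.4) p.670] -/
theorem king_complex_window_structure [Nonempty n] (hc : 0 < c) (hm : 0 < m2) (hε : 0 ≤ ε) :
    ((∀ U V : Tor K × Fin (d + 1) → Matrix n n 𝕜, (∀ b, ‖U b‖ ≤ 1 + ε) → (∀ b, ‖V b‖ ≤ 1 + ε) → IsUnit (cxLapF K c m2 U V))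
        ↔ 2 * ((d : ℝ) + 1) * c * ε < m2)
    ∧ ((∀ U : Tor K × Fin (d + 1) → Matrix n n 𝕜, (∀ b, ‖U b‖ ≤ 1 + ε) → IsUnit (covLapF K c m2 U)) ↔ 2 * ((d : ℝ) + 1) * c * ε < m2)
    ∧ (∀ {U : Tor K × Fin (d + 1) → Matrix n n 𝕜}, (∀ b, U b ∈ Matrix.unitaryGroup n 𝕜) → ∀ x y, ‖blk (covLapF K c m2 U)⁻¹ x y‖ ≤ (lapF K c m2)⁻¹ x y)
    ∧ (∀ {g : Tor K → Matrix n n 𝕜}, (∀ x, IsUnit (g x)) → IsUnit (cxLapF K c m2 (cxGaugeFwd K g Hopping.free) (cxGaugeBwd K g Hopping.free)))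
    ∧ (∀ {g : Tor K → Matrix n n 𝕜} (U V : Tor K × Fin (d + 1) → Matrix n n 𝕜), (∀ x, IsUnit (g x)) →
        (IsUnit (cxLapF K c m2 (cxGaugeFwd K g U) (cxGaugeBwd K g V)) ↔ IsUnit (cxLapF K c m2 U V)))
    ∧ (∀ {g : Tor K → Matrix n n 𝕜} (U V : Tor K × Fin (d + 1) → Matrix n n 𝕜), (∀ x, IsUnit (g x)) →
        (cxLapF K c m2 (cxGaugeFwd K g U) (cxGaugeBwd K g V)).det = (cxLapF K c m2 U V).det) :=
  ⟨forall_isUnit_cxLapF_iff K hc hm hε,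
   forall_isUnit_covLapF_iff K hc hm hε,
   fun hU x y => l2_opNorm_blk_inv_le_of_window K hc.le hm hU x y,
   fun hg => isUnit_cxLapF_pureGauge K hc.le hm hg,
   fun U V hg => isUnit_cxLapF_gauge_iff K c m2 hg U V,
   fun U V hg => det_cxLapF_gauge K c m2 hg U V⟩

/-- ★★ **PART Ϛ BY NAME, III — OVER `ℂ`**: on the window (`c ≥ 0`, `m² > 0`, `0 ≤ ε`, `2(d+1)cε < m²`, `‖U(b)‖, ‖V(b)‖ ≤ 1+ε`): (i) `(m² − 2(d+1)cε)^{|T×n|} ≤ ‖det M_{U,V}‖` and (ii)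
`‖det M_{U,V}‖ ≤ (m²+2(d+1)c(2+ε))^{|T×n|}` (the complex Gaussian normalisation); (iii) CAUCHY ESTIMATES: for unit directions and `R > 0` with `2(d+1)c(ε+R) < m²`,
`‖(d∕dt)ᵏ(G_{U+tδU,V+tδV})_{xy}|_{t=0}‖ ≤ k!·(m²−2(d+1)c(ε+R))⁻¹∕Rᵏ` for every `k`; (iv) for every unitary `U₀`, print's chart `A ↦ G(e^{A}U₀)` is analytic at `A = 0`.
[cite: Balaban1985BackgroundPropagators, Thm 3.4 p.400, p.399 l.33–36, p.400 l.1–4, (3.57) p.401; King1986, (3.89) p.668, (4.4) p.670] -/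
theorem king_complex_window_package_complex {ν : Type*} [Fintype ν] [DecidableEq ν] {c m2 ε : ℝ} (hc : 0 ≤ c) (hm : 0 < m2) (hε : 0 ≤ ε)
    (hwin : 2 * ((d : ℝ) + 1) * c * ε < m2) {U V : Tor K × Fin (d + 1) → Matrix ν ν ℂ} (hU : ∀ b, ‖U b‖ ≤ 1 + ε) (hV : ∀ b, ‖V b‖ ≤ 1 + ε) :
    (m2 - 2 * ((d : ℝ) + 1) * c * ε) ^ Fintype.card (Tor K × ν) ≤ ‖(cxLapF K c m2 U V).det‖
    ∧ ‖(cxLapF K c m2 U V).det‖ ≤ (m2 + 2 * ((d : ℝ) + 1) * c * (2 + ε)) ^ Fintype.card (Tor K × ν)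
    ∧ (∀ {δU δV : Tor K × Fin (d + 1) → Matrix ν ν ℂ} {R : ℝ}, (∀ b, ‖δU b‖ ≤ 1) → (∀ b, ‖δV b‖ ≤ 1) → 0 < R →
        2 * ((d : ℝ) + 1) * c * (ε + R) < m2 → ∀ (k : ℕ) (x y : Tor K),
        ‖iteratedDeriv k (fun s : ℂ => blk (cxLapF K c m2 (U + s • δU) (V + s • δV))⁻¹ x y) 0‖
          ≤ k.factorial * (m2 - 2 * ((d : ℝ) + 1) * c * (ε + R))⁻¹ / R ^ k)
    ∧ (∀ {U₀ : Tor K × Fin (d + 1) → Matrix ν ν ℂ}, (∀ b, U₀ b ∈ Matrix.unitaryGroup ν ℂ) →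
        AnalyticAt ℂ (fun A : Tor K × Fin (d + 1) → Matrix ν ν ℂ => (cxLapF K c m2 (expLink K A U₀) (expLinkInv K A U₀))⁻¹) 0) :=
  ⟨pow_le_norm_det_cxLapF K hc hε hwin hU hV,
   norm_det_cxLapF_le_pow K hc hm hε hU hV,
   fun hδU hδV hR hwinR k x y => norm_iteratedDeriv_blk_cxLapF_inv_line_le K hc hm hε hR hwinR hU hV hδU hδV k x y,
   fun hU₀ => analyticAt_cxLapF_inv_expChart_zero K hc hm hU₀⟩

end Summit.QuantumFields.YangMills.BalabanUVNodes.N15KingModelRung.Covariant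

end
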